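import Summits.QuantumFields.YangMills.Theses.BalabanLadder
import Summits.QuantumFields.YangMills.Theorems.BalabanLadderIRColdPressurePincer
import Literature.MathematicalPhysics.QuantumLattice.WilsonLoops
import HarnessLib

/-!
# Crux `IR` (item stmt-QuantumFields-19354, route-QuantumFields-BalabanLadder) — vocabulary and PROVED seams of the line
`tension-ratio` (ideator ym-ir-idea-7 g0; technique lens: large-N ∕ reduced models as CALIBRATION only)

Helper module for item `stmt-QuantumFields-19354` (`--supports … --as helper`; it closes nothing).  Route-posited objects of the
REGISTERED skeleton `Cruxes/IR/Lines/ym_ir7_tension_ratio.lean` (commit 2db9695cba9c; critics ym-ir-crit-1 ∕ ym-ir-crit-2: PASS-WITH-PRICE),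
made tree constants so that every registered stub (`stub_tensionFloor : TensionFloor`, `stub_ratioFloor : RatioFloorSC`,
`stub_irCentreFree : IRscCentreFree`, and the two strong-coupling RUNG stubs `stub_rung_tensionStrongCoupling : TensionStrongCoupling`,
`stub_rung_ratioStrongCoupling : RatioStrongCoupling`) can be closed by a `Theorems/` file proving a constant of THIS module BY NAME, and so
that the skeleton re-bases on `import …Theorems.IR.TensionRatioDefs`.  The statements are VERBATIM the skeleton's; the stubs themselves are NOT
here; NOTHING below the `def`s is asserted except the three real proofs of §2–§3 (`coldPressureBound_mono_rate`, the reusable rate-in-units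
seam `gapInUnits_of_rate_in_units`, `irsc_of_tension_ratio`) and the hypotheses-form composition `ir_of_tension_ratio :
TensionFloor → RatioFloorSC → IRscCentreFree → IRnsc → IR` (kernel-checked, no `sorry`; the skeleton's `IR_of` is this term applied to
its four stubs).

LEVER (new on this crux): the **dimensionless mass ∕ string-tension RATIO FLOOR** `m ≥ c·√σ` as a typed, scale-free obligation
(`RatioFloorSC`: on all large tori, an area law for ONE centre-charged Wilson loop at areal rate `s` forces the cold trace bound at
rate `c·√s` — «no excitation parametrically lighter than the string scale»), composed with **confinement in units along the scaling
trajectory** (`TensionFloor`: area law at rate `σ₀·a(β)²`, volume by volume, for simply-connected simple `G` with non-trivial centre).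
`√(σ₀ a²) = √σ₀ · a` turns the pair into per-β cold pressure at rate `c√σ₀·a(β)`, and the landed rate seam
`ColdPressurePincer.gapInUnits_of_coldPressure_pinned` gives `GapInUnits`.  This is the CONVERSE bridge «area law ⇒ gap» that the desk's
REDUCTION-CENSUS records as absent from print (§C4 ∕ §G.3: the printed direction is gap ⇒ confinement), stated honestly as an obligation,
with its two residual halves declared: the CENTRE-FREE simply-connected groups (`G₂, F₄, E₈`: no asymptotic area law exists, confinement =
screening — the lever has no content there) and the flux-sector half `IRnsc` (`π₁(G) ≠ 1`, as in the cold-pressure pincer).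

CALIBRATION (the lens; numbers, not mechanism): `m_{0++}∕√σ = 3.28(8) + 2.1(1.1)∕N²` in the continuum limit for all `N` (Lucini–Teper–Wenger,
[corpus:paper:arxiv-1210.4997 p.53]) — an `N`-UNIFORM floor `≈ 3.3`; strong coupling: `m ≈ −4 log β`, `σ ≈ −log(β∕4)` so `m∕√σ → ∞` as `β → 0`
(Osterwalder–Seiler 1978; Münster's strong-coupling glueball series [corpus:book:montvay1994-quantum-fields-lattice p.160–161]); closed-string ∕
flux-tube models put the lightest glueball at `c√σ` with `c = O(1)` universal.  The ratio floor is insensitive to dimensional transmutation: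
both `m` and `√σ` are `e^{-cβ}`-small, their ratio is not.

HONEST FRAMING: a kernel-checked CONDITIONAL reduction of ONE binder (`IR`, rung R2c) of a CONDITIONAL chain; `TensionFloor` is the
confinement problem in units (OPEN since Wilson 1974 beyond strong coupling), `RatioFloorSC` is an unprinted bridge obligation; two residual
halves are carried OPEN; the YM mass gap (Clay) is NOT proved by any of this; R4 closes only the conditional finite-𝕋⁴ rung `BalabanLadder.UV`.
The `def … : Prop` below are line statements (hypotheses), not literature facts and not claims; the two `*StrongCoupling` Props are FORMAT
rungs inside `IR`'s known regime (Osterwalder–Seiler 1978), not witnesses of weakness.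

Refs: line card `Cruxes/IR/Lines/ym-ir7-tension-ratio.md`; crux idea `Cruxes/IR/Ideas/ym-ir7-tension-ratio.md`; critics
`pub/ym-ir/ym-ir-crit-1` ∕ `ym-ir-crit-2` VERDICT-tension-ratio; the landed cold-pressure seams
`Theorems/BalabanLadderIRColdPressurePincer.lean` (`gapInUnits_of_coldPressure_pinned`, `IR_of_cases`, `cpLength_le`); torus Wilson loops
`Literature/MathematicalPhysics/QuantumLattice/WilsonLoops.lean`; K. Osterwalder, E. Seiler, Ann. Phys. 110 (1978) 440, §3 and §5.
-/

set_option autoImplicit false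

noncomputable section

open Filter Topology MeasureTheory
open Literature.MathematicalPhysics.QuantumFieldTheory Literature.MathematicalPhysics.QuantumLattice
open Summit.QuantumFields.YangMills.Cruxes.OSLegsFromFemtoAndGap.DlrCollarTransfer (GapInUnits LowerBounds)
open Literature.MathematicalPhysics.QuantumFieldTheory.Balaban1983to89.Sufficient (ColdPressureBound)
open Summit.QuantumFields.YangMills.Cruxes.IR.ColdPressurePincer
  (ColdPressureAt cpLength cpLength_le IRsc IRnsc IR_of_cases gapInUnits_of_coldPressure_pinned)

namespace Summit.QuantumFields.YangMills.Cruxes.IR.TensionRatio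

/-! ## §0 The torus Wilson loop and the stub STATEMENTS -/

section Defs

variable {G : Type} [Group G] [TopologicalSpace G] [IsTopologicalGroup G] [CompactSpace G]
  [MeasurableSpace G] [BorelSpace G]

/-- The `R × T` rectangular Wilson loop in the `(0,1)` plane, class function `χ`, under the periodic Wilson measure
`wilsonMeasure ρ β` on the torus of side `2S+1` (periodic lift; tree parts `wilsonLoopObs`, `rectWalk`, `torusLift`). -/
def torusRect {N : ℕ} (ρ : G →* Matrix (Fin N) (Fin N) ℂ) (χ : G → ℝ) (β : ℝ) (S R T : ℕ) : ℝ :=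
  ∫ U, wilsonLoopObs χ (rectWalk (0 : Literature.Probability.LatticeModels.Site 4) 0 1 R T) (torusLift (2 * S + 1) U)
    ∂(wilsonMeasure (d := 4) (L := 2 * S + 1) ρ β)

/-- Area law with perimeter constant `C` and areal rate `s` for the loops of `χ` that fit in the torus of half-side `S`
(the torus form of `QuantumLattice.HasAreaLawWith`). -/
def TorusAreaLaw {N : ℕ} (ρ : G →* Matrix (Fin N) (Fin N) ℂ) (χ : G → ℝ) (β : ℝ) (S : ℕ) (C s : ℝ) : Prop :=
  ∀ R T : ℕ, 1 ≤ R → 1 ≤ T → R ≤ S → T ≤ S →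
    |torusRect ρ χ β S R T| ≤ C ^ (2 * (R + T)) * Real.exp (-(s * R * T))

end Defs

/-- **stub T1 — CONFINEMENT IN UNITS ALONG THE TRAJECTORY (simply-connected simple `G` with non-trivial centre).**  For every
`(G, r)` and every positive unit map `a → 0` carrying the non-triviality floors (`LowerBounds`, the unit pin), there is a CENTRE-CHARGED
continuous matrix representation `π` (`π z = ω·1`, `z` central, `ω ≠ 1`, so every summand has the same non-zero `N`-ality; `0 < N` kills the
junk character) whose Wilson loops under the `r`-Wilson measure obey, for all large `β` and all large tori, an area law with perimeter
constant `C` and areal rate `σ₀·a(β)²` — string tension `≥ σ₀` in physical units.  Wall: confinement at weak coupling (Wilson 1974; open);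
tools: centre symmetry ∕ 't Hooft flux ∕ vortex free energies, RP flux inequalities (Tomboulis–Yaffe), Durhuus–Fröhlich (tree, `β < 2∕3`). [open] -/
def TensionFloor : Prop :=
  ∀ (G : Type) [Group G] [TopologicalSpace G] [IsTopologicalGroup G] [CompactSpace G],
    IsCompactSimpleLieGroup G → SimplyConnectedSpace G → (∃ z : G, z ∈ Subgroup.center G ∧ z ≠ 1) →
    letI : MeasurableSpace G := borel G; haveI : BorelSpace G := ⟨rfl⟩;
    ∀ (r : LatticeRep G) (a : ℝ → ℝ), (∀ β, 0 < a β) → Tendsto a atTop (nhds 0) → LowerBounds G r a →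
      ∃ (N : ℕ) (π : G →* Matrix (Fin N) (Fin N) ℂ) (z : G) (ω : ℂ), 0 < N ∧ Continuous π ∧ z ∈ Subgroup.center G ∧ ω ≠ 1 ∧
        π z = ω • (1 : Matrix (Fin N) (Fin N) ℂ) ∧
        ∃ σ₀ : ℝ, 0 < σ₀ ∧ ∃ C β₄ : ℝ, ∀ β : ℝ, β₄ ≤ β → ∃ S₂ : ℕ, ∀ S : ℕ, S₂ ≤ S →
          TorusAreaLaw r.ρ (fun g => normalisedCharacter N (π g)) β S C (σ₀ * a β ^ 2)

/-- **stub T2 — THE RATIO FLOOR `m ≥ c√σ` (simply-connected simple `G`; scale-free, unit-free).**  For every `(G, r)` and every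
centre-charged `π` there are `c > 0` and `β₀` such that for every `β ≥ β₀`, every areal rate `s > 0` and every perimeter constant `C`: if
the `π`-loops obey the area law `(C, s)` on all large tori, then the cold trace bound holds on all large tori at rate `c·√s` (with some
amplitude constant).  Content: no state in the charge-free sector is parametrically lighter than the string scale set by ANY confining loop;
trivially consistent at strong coupling (`m∕√σ → ∞`), `N`-uniformly calibrated at weak coupling (`m∕√σ → 3.28 + 2.1∕N²`); it does NOT assert a
gap (vacuous without an area law) and does NOT assert confinement.  No tool on record (closed-string heuristics only). [conjectural obligation; open] -/
def RatioFloorSC : Prop :=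
  ∀ (G : Type) [Group G] [TopologicalSpace G] [IsTopologicalGroup G] [CompactSpace G],
    IsCompactSimpleLieGroup G → SimplyConnectedSpace G →
    letI : MeasurableSpace G := borel G; haveI : BorelSpace G := ⟨rfl⟩;
    ∀ (r : LatticeRep G) (N : ℕ) (π : G →* Matrix (Fin N) (Fin N) ℂ) (z : G) (ω : ℂ), 0 < N → Continuous π →
      z ∈ Subgroup.center G → ω ≠ 1 → π z = ω • (1 : Matrix (Fin N) (Fin N) ℂ) →
      ∃ c : ℝ, 0 < c ∧ ∃ β₀ : ℝ, ∀ β : ℝ, β₀ ≤ β → ∀ s : ℝ, 0 < s → ∀ C : ℝ,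
        (∃ S₂ : ℕ, ∀ S : ℕ, S₂ ≤ S → TorusAreaLaw r.ρ (fun g => normalisedCharacter N (π g)) β S C s) →
          ∃ C₀ : ℝ, 0 ≤ C₀ ∧ ∃ S₃ : ℕ, ∀ S : ℕ, S₃ ≤ S → ColdPressureBound r.ρ β S (c * Real.sqrt s) C₀

/-- **residual R_CF — the crux restricted to the CENTRE-FREE simply-connected simple groups (`G₂, F₄, E₈`).**  There every Wilson loop is
screened (no asymptotic area law), so the tension lever is empty; carried OPEN and declared as a residual. [open] -/
def IRscCentreFree : Prop :=
  ∀ (G : Type) [Group G] [TopologicalSpace G] [IsTopologicalGroup G] [CompactSpace G],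
    IsCompactSimpleLieGroup G → SimplyConnectedSpace G → (∀ z : G, z ∈ Subgroup.center G → z = 1) →
    letI : MeasurableSpace G := borel G; haveI : BorelSpace G := ⟨rfl⟩;
    ∀ (r : LatticeRep G) (a : ℝ → ℝ), (∀ β, 0 < a β) → Tendsto a atTop (nhds 0) → LowerBounds G r a → GapInUnits G r a

/-! ### BC5-type RUNGS (typed; strong-coupling instances of the two formats — FORMAT exercise inside `IR`'s known regime,
not witnesses of weakness; requested by ym-ir-crit-1's standing rule «pincer-currency lines carry a typed rung») -/

/-- **rung T1-sc — area law on ALL TORI at strong coupling for centre-charged loops.**  For `0 < β ≤ β_D(G,r,π)` every torus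
`(2S+1)⁴` carries `TorusAreaLaw r.ρ χ_π β S C s` with ONE `(C, s > 0)` for all `S` (Osterwalder–Seiler 1978 cluster expansion, torus
version; the tree PROVES the free-b.c. `SU(N)` sibling `QuantumFieldTheory.osterwalderSeiler_areaLaw_holds`; non-zero `N`-ality of `π` forces a
full tiling of the minimal surface).  Size M–L. [rung; provable] -/
def TensionStrongCoupling : Prop :=
  ∀ (G : Type) [Group G] [TopologicalSpace G] [IsTopologicalGroup G] [CompactSpace G],
    IsCompactSimpleLieGroup G → SimplyConnectedSpace G →
    letI : MeasurableSpace G := borel G; haveI : BorelSpace G := ⟨rfl⟩;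
    ∀ (r : LatticeRep G) (N : ℕ) (π : G →* Matrix (Fin N) (Fin N) ℂ) (z : G) (ω : ℂ), 0 < N → Continuous π →
      z ∈ Subgroup.center G → ω ≠ 1 → π z = ω • (1 : Matrix (Fin N) (Fin N) ℂ) →
      ∃ βD : ℝ, 0 < βD ∧ ∀ β : ℝ, 0 < β → β ≤ βD → ∃ C s : ℝ, 0 < s ∧ ∀ S : ℕ,
        TorusAreaLaw r.ρ (fun g => normalisedCharacter N (π g)) β S C s

/-- **rung T2-sc — the ratio format at strong coupling.**  For `0 < β ≤ β_D`: an area law `(C, s)` for the `π`-loops on all large tori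
forces `s ≤ s_max(β)` (Seiler's a-priori LOWER bound on Wilson loops, `σ(β) ≤ O(−ln β)`), and the strong-coupling transfer gap on tori
(`m(β) = −4 ln u + …`, volume-uniform, Osterwalder–Seiler ∕ Münster) gives `ColdPressureBound` at rate `≥ c·√s_max(β) ≥ c√s`.  Three
strong-coupling facts + arithmetic; size L. [rung; provable] -/
def RatioStrongCoupling : Prop :=
  ∀ (G : Type) [Group G] [TopologicalSpace G] [IsTopologicalGroup G] [CompactSpace G],
    IsCompactSimpleLieGroup G → SimplyConnectedSpace G →
    letI : MeasurableSpace G := borel G; haveI : BorelSpace G := ⟨rfl⟩;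
    ∀ (r : LatticeRep G) (N : ℕ) (π : G →* Matrix (Fin N) (Fin N) ℂ) (z : G) (ω : ℂ), 0 < N → Continuous π →
      z ∈ Subgroup.center G → ω ≠ 1 → π z = ω • (1 : Matrix (Fin N) (Fin N) ℂ) →
      ∃ c : ℝ, 0 < c ∧ ∃ βD : ℝ, 0 < βD ∧ ∀ β : ℝ, 0 < β → β ≤ βD → ∀ s : ℝ, 0 < s → ∀ C : ℝ,
        (∃ S₂ : ℕ, ∀ S : ℕ, S₂ ≤ S → TorusAreaLaw r.ρ (fun g => normalisedCharacter N (π g)) β S C s) →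
          ∃ C₀ : ℝ, 0 ≤ C₀ ∧ ∃ S₃ : ℕ, ∀ S : ℕ, S₃ ≤ S → ColdPressureBound r.ρ β S (c * Real.sqrt s) C₀

/-! ## §1 (The registered stubs `stub_tensionFloor`, `stub_ratioFloor`, `stub_irCentreFree`, `stub_irNSC`, `stub_rung_tensionStrongCoupling`,
`stub_rung_ratioStrongCoupling` live in the skeleton `Cruxes/IR/Lines/ym_ir7_tension_ratio.lean`, not here.) -/

/-! ## §2 Seams (real proofs) -/

section Seams

variable {G : Type} [Group G] [TopologicalSpace G] [IsTopologicalGroup G] [CompactSpace G]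
  [MeasurableSpace G] [BorelSpace G]

/-- A smaller rate is a weaker cold trace bound. -/
theorem coldPressureBound_mono_rate {N : ℕ} {ρ : G →* Matrix (Fin N) (Fin N) ℂ} {β : ℝ} {S : ℕ}
    {g g' C₀ : ℝ} (h : ColdPressureBound ρ β S g C₀) (hC₀ : 0 ≤ C₀) (hg : g' ≤ g) :
    ColdPressureBound ρ β S g' C₀ := by
  intro m hm
  refine (h m hm).trans ?_
  have hV : 0 ≤ C₀ * ((2 * S + 1 : ℕ) : ℝ) ^ 3 := by positivity
  refine mul_le_mul_of_nonneg_left (Real.exp_le_exp.2 ?_) hV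
  have hm0 : (0 : ℝ) ≤ ((m + 2 : ℕ) : ℝ) := Nat.cast_nonneg _
  nlinarith

/-- **Rate-in-units seam (real proof, reusable):** per-β cold trace bounds on all large tori at a rate `κ·a(β)` that is LINEAR IN THE
UNIT give `GapInUnits` — the admissible length `⌈1∕(κ aβ)⌉₊` is pinned by `aβ·ξ < 1∕κ + 2`, then `gapInUnits_of_coldPressure_pinned`. -/
theorem gapInUnits_of_rate_in_units (r : LatticeRep G) (a : ℝ → ℝ) (ha : ∀ β, 0 < a β)
    (ha0 : Tendsto a atTop (nhds 0)) {κ β₈ : ℝ} (hκ : 0 < κ)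
    (hcp : ∀ β : ℝ, β₈ ≤ β → ∃ C₀ : ℝ, 0 ≤ C₀ ∧ ∃ S₃ : ℕ, ∀ S : ℕ, S₃ ≤ S → ColdPressureBound r.ρ β S (κ * a β) C₀) :
    GapInUnits G r a := by
  -- eventually `a β ≤ 1`
  obtain ⟨β₇, hβ₇⟩ : ∃ β₇ : ℝ, ∀ β : ℝ, β₇ ≤ β → a β ≤ 1 := by
    have hev : ∀ᶠ β in atTop, a β < 1 := ha0.eventually (gt_mem_nhds one_pos)
    obtain ⟨β₇, h⟩ := Filter.eventually_atTop.1 hev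
    exact ⟨β₇, fun β hβ => (h β hβ).le⟩
  have hrate : ∀ β : ℝ, 1 / ((⌈1 / (κ * a β)⌉₊ : ℕ) : ℝ) ≤ κ * a β := by
    intro β
    have hapos := ha β
    have hx : 0 < 1 / (κ * a β) := by positivity
    have hce : 1 / (κ * a β) ≤ ((⌈1 / (κ * a β)⌉₊ : ℕ) : ℝ) := Nat.le_ceil _
    calc 1 / ((⌈1 / (κ * a β)⌉₊ : ℕ) : ℝ) ≤ 1 / (1 / (κ * a β)) := one_div_le_one_div_of_le hx hce
      _ = κ * a β := by field_simp
  have hξ1 : ∀ β : ℝ, 1 ≤ ⌈1 / (κ * a β)⌉₊ := by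
    intro β
    have hapos := ha β
    have hx : 0 < 1 / (κ * a β) := by positivity
    exact Nat.one_le_iff_ne_zero.2 (Nat.pos_iff_ne_zero.1 (Nat.ceil_pos.2 hx))
  have hat : ∀ β : ℝ, β₈ ≤ β → ColdPressureAt r.ρ β ⌈1 / (κ * a β)⌉₊ := by
    intro β hβ
    obtain ⟨C₀, hC₀, S₃, hS⟩ := hcp β hβ
    exact ⟨C₀, S₃, hC₀, fun S hSS => coldPressureBound_mono_rate (hS S hSS) hC₀ (hrate β)⟩
  have hon : ∀ β : ℝ, β₈ ≤ β → ∃ ξ : ℕ, 1 ≤ ξ ∧ ColdPressureAt r.ρ β ξ := fun β hβ => ⟨_, hξ1 β, hat β hβ⟩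
  have hpin : ∀ β : ℝ, max β₈ β₇ ≤ β → a β * (cpLength r.ρ β : ℝ) < 1 / κ + 2 := by
    intro β hβ
    have hβ8 : β₈ ≤ β := le_trans (le_max_left _ _) hβ
    have hβ7 : β₇ ≤ β := le_trans (le_max_right _ _) hβ
    have hapos := ha β
    have ha1 := hβ₇ β hβ7
    have hx : 0 < 1 / (κ * a β) := by positivity
    have hle : cpLength r.ρ β ≤ ⌈1 / (κ * a β)⌉₊ := cpLength_le r.ρ β (hξ1 β) (hat β hβ8)
    have hle' : (cpLength r.ρ β : ℝ) ≤ ((⌈1 / (κ * a β)⌉₊ : ℕ) : ℝ) := by exact_mod_cast hle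
    have hlt : ((⌈1 / (κ * a β)⌉₊ : ℕ) : ℝ) < 1 / (κ * a β) + 1 := Nat.ceil_lt_add_one hx.le
    have h1 : a β * (cpLength r.ρ β : ℝ) ≤ a β * ((⌈1 / (κ * a β)⌉₊ : ℕ) : ℝ) :=
      mul_le_mul_of_nonneg_left hle' hapos.le
    have h2 : a β * ((⌈1 / (κ * a β)⌉₊ : ℕ) : ℝ) < a β * (1 / (κ * a β) + 1) := mul_lt_mul_of_pos_left hlt hapos
    have h3 : a β * (1 / (κ * a β) + 1) = 1 / κ + a β := by field_simp
    linarith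
  exact gapInUnits_of_coldPressure_pinned r a ha ha0 hon hpin

end Seams

/-- **T1 ∧ T2 ∧ R_CF ⇒ `IRsc` (real proof).**  With a centre: T1 gives a centre-charged `π` confining at areal rate `σ₀ a(β)²`; T2 at
`s = σ₀ a(β)²` gives cold pressure at rate `c·√(σ₀ a²) = (c√σ₀)·a(β)`; the rate-in-units seam concludes.  Without a centre: R_CF. -/
theorem irsc_of_tension_ratio (hT1 : TensionFloor) (hT2 : RatioFloorSC) (hCF : IRscCentreFree) : IRsc := by
  intro G _ _ _ _ hG hsc
  letI : MeasurableSpace G := borel G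
  haveI : BorelSpace G := ⟨rfl⟩
  intro r a ha ha0 hlb
  by_cases hZ : ∃ z : G, z ∈ Subgroup.center G ∧ z ≠ 1
  · obtain ⟨N, π, z, ω, hN, hπ, hz, hω, hπz, σ₀, hσ₀, C, β₄, hT⟩ := hT1 G hG hsc hZ r a ha ha0 hlb
    obtain ⟨c, hc, β₀, hR⟩ := hT2 G hG hsc r N π z ω hN hπ hz hω hπz
    have hκ : 0 < c * Real.sqrt σ₀ := mul_pos hc (Real.sqrt_pos.2 hσ₀)
    refine gapInUnits_of_rate_in_units r a ha ha0 (β₈ := max β₄ β₀) hκ fun β hβ => ?_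
    have hβ4 : β₄ ≤ β := le_trans (le_max_left _ _) hβ
    have hβ0 : β₀ ≤ β := le_trans (le_max_right _ _) hβ
    have hs : 0 < σ₀ * a β ^ 2 := mul_pos hσ₀ (pow_pos (ha β) 2)
    obtain ⟨C₀, hC₀, S₃, hS⟩ := hR β hβ0 (σ₀ * a β ^ 2) hs C (hT β hβ4)
    refine ⟨C₀, hC₀, S₃, fun S hSS => ?_⟩
    have hsq : Real.sqrt (σ₀ * a β ^ 2) = Real.sqrt σ₀ * a β := by
      rw [Real.sqrt_mul hσ₀.le, Real.sqrt_sq (ha β).le]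
    have h := hS S hSS
    rw [hsq, ← mul_assoc] at h
    exact h
  · push Not at hZ
    exact hCF G hG hsc hZ r a ha ha0 hlb

/-! ## §3 Composition: the crux `IR` BY NAME (hypotheses form) -/

/-- **Composition in hypotheses form (kernel-checked, no `sorry`):** `TensionFloor → RatioFloorSC → IRscCentreFree → IRnsc →` crux `IR`
BY NAME.  The skeleton's `IR_of` is this term applied to its four registered stubs; nothing is discharged here. -/
theorem ir_of_tension_ratio (hT1 : TensionFloor) (hT2 : RatioFloorSC) (hCF : IRscCentreFree) (hN : IRnsc) :
    Summit.QuantumFields.YangMills.Theses.BalabanLadder.IR :=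
  IR_of_cases (irsc_of_tension_ratio hT1 hT2 hCF) hN


/-! ## §4 (v1.4 of the line) The window rungs — tree constants for the registered stubs `stub_rung_ratioStrongCouplingWindow`,
`stub_rung_ratioStrongCouplingWindowRP` (statements VERBATIM skeleton v1.4 `04e7cc7efbc5`; typed obligations, not claims; the RP instance is
proved in `Theorems/IR/TensionRatioWindowRP.lean`) -/

/-- **rung T2-sc-window — the ratio format on a COMPACT strong-coupling window.**  For every simply-connected compact simple `G`, every
faithful lattice representation `r` and every centre-charged continuous `π` there is `βD > 0` such that for every window `[β₁, βD]`
(`0 < β₁ ≤ βD`) there is `c = c(β₁) > 0` with: for all `β ∈ [β₁, βD]`, all `s > 0`, all `C`, the area law `(C, s)` for the `π`-loops on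
all large tori implies the cold trace bound at rate `c·√s` on all large tori.  Landable from (i) the torus Seiler/Bachas bound
`W_π(1,1)^{RT} ≤ W_π(R,T)` for loops in an arbitrary unitary rep under the `r`-Wilson torus state (RP; ym-ir-lit-4's offer, ≈ 300–400
lines, siblings `StaticPotential.plaquette_pow_le_rectExpectation`, `ConstructiveQFTWave0WilsonLoopRPProofs`), (ii) a volume-uniform
strong-coupling LOWER bound `W_π(1,1) ≥ w(β₁) > 0` on the window (OS78 cluster expansion: leading term `m_k β^k/…`, `m_k ≥ 1` by
faithfulness / Burnside–Brauer; `βD` may be shrunk by the prover), whence `s ≤ ln(1/w(β₁))` for any admissible `(C, s)` (take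
`R = T = S → ∞`), (iii) the tree's `ColdPressurePincer.coldPressureAt_strongCoupling` (rate `1/8`, every compact `G`,
`0 ≤ β ≤ strongCouplingRadius r.ρ`) and `coldPressureBound_mono_rate`, with `c(β₁) := 1/(8·√(ln(1/w(β₁))))` (if `w ≥ 1` the hypothesis
set is empty for every `s > 0`).  Size L.  Like every rung here it sits inside `IR`'s known regime and exercises the FORMAT of T2 only.
[rung; open — a typed obligation of the line, not a published statement] -/
def RatioStrongCouplingWindow : Prop :=
  ∀ (G : Type) [Group G] [TopologicalSpace G] [IsTopologicalGroup G] [CompactSpace G],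
    IsCompactSimpleLieGroup G → SimplyConnectedSpace G →
    letI : MeasurableSpace G := borel G; haveI : BorelSpace G := ⟨rfl⟩;
    ∀ (r : LatticeRep G) (N : ℕ) (π : G →* Matrix (Fin N) (Fin N) ℂ) (z : G) (ω : ℂ), 0 < N → Continuous π →
      z ∈ Subgroup.center G → ω ≠ 1 → π z = ω • (1 : Matrix (Fin N) (Fin N) ℂ) →
      ∃ βD : ℝ, 0 < βD ∧ ∀ β₁ : ℝ, 0 < β₁ → β₁ ≤ βD → ∃ c : ℝ, 0 < c ∧ ∀ β : ℝ, β₁ ≤ β → β ≤ βD → ∀ s : ℝ, 0 < s → ∀ C : ℝ,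
        (∃ S₂ : ℕ, ∀ S : ℕ, S₂ ≤ S → TorusAreaLaw r.ρ (fun g => normalisedCharacter N (π g)) β S C s) →
          ∃ C₀ : ℝ, 0 ≤ C₀ ∧ ∃ S₃ : ℕ, ∀ S : ℕ, S₃ ≤ S → ColdPressureBound r.ρ β S (c * Real.sqrt s) C₀

/-- **The window rung is weaker than the `(0, βD]`-uniform rung (real proof):** a constant uniform on `(0, βD]` serves every window. -/
theorem ratioStrongCouplingWindow_of_ratioStrongCoupling (h : RatioStrongCoupling) : RatioStrongCouplingWindow := by
  intro G _ _ _ _ hG hsc r N π z ω hN hπ hz hω hπz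
  obtain ⟨c, hc, βD, hβD, hmain⟩ := h G hG hsc r N π z ω hN hπ hz hω hπz
  refine ⟨βD, hβD, fun β₁ hβ₁ _ => ⟨c, hc, fun β hβ₁β hββD s hs C hAL => ?_⟩⟩
  exact hmain β (lt_of_lt_of_le hβ₁ hβ₁β) hββD s hs C hAL

/-- **rung T2-sc-window-RP — the window shape for the special-unitary fundamental model, area law read on even tori.**  For every
simply-connected compact simple `G` and every lattice representation `r` that is a special-unitary model (`range r.ρ = SU(N)`, `N ≥ 2`, so
`π := r.ρ` is centre-charged) there is `βD > 0` such that for every window `[β₁, βD]` there is `c = c(β₁) > 0` with: for all `β ∈ [β₁, βD]`,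
all `s > 0`, all `C`, an area law `(C, s)` for the fundamental `R×T` loops in the `(0,1)` plane on all large EVEN tori (`2R, 2T ≤ L`) implies the
cold trace bound at rate `c·√s` on all large odd tori `2S+1`.  Proof recipe and tree inputs: file header v1.4 ((i) p592927 torus Seiler/Bachas,
(ii) `wilsonExpectation_plaquette_ge`, (iii) `coldPressureAt_strongCoupling` + `coldPressureBound_mono_rate`).  Inside `IR`'s known regime; exercises
T2's interfaces (area-law hypothesis ⇒ rate cap ⇒ cold pressure at rate `∝ √s`) in the kernel; not consumed by `IR_of`.  Size M–L.
[rung; provable — proved in `Theorems/IR/TensionRatioWindowRP.lean`] -/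
def RatioStrongCouplingWindowRP : Prop :=
  ∀ (G : Type) [Group G] [TopologicalSpace G] [IsTopologicalGroup G] [CompactSpace G],
    IsCompactSimpleLieGroup G → SimplyConnectedSpace G →
    letI : MeasurableSpace G := borel G; haveI : BorelSpace G := ⟨rfl⟩;
    ∀ (r : LatticeRep G), IsSpecialUnitaryModel r.ρ → 2 ≤ r.N →
      ∃ βD : ℝ, 0 < βD ∧ ∀ β₁ : ℝ, 0 < β₁ → β₁ ≤ βD → ∃ c : ℝ, 0 < c ∧ ∀ β : ℝ, β₁ ≤ β → β ≤ βD → ∀ s : ℝ, 0 < s → ∀ C : ℝ,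
        (∃ L₂ : ℕ, ∀ (L : ℕ) [NeZero L], L₂ ≤ L → Even L → ∀ R T : ℕ, 1 ≤ R → 1 ≤ T → 2 * R ≤ L → 2 * T ≤ L →
            |wilsonExpectation r.ρ β (wilsonLoop r.ρ (0 : Literature.MathematicalPhysics.QuantumFieldTheory.Site 4 L) 0 1 R T)| ≤
              C ^ (2 * (R + T)) * Real.exp (-(s * R * T))) →
          ∃ C₀ : ℝ, 0 ≤ C₀ ∧ ∃ S₃ : ℕ, ∀ S : ℕ, S₃ ≤ S → ColdPressureBound r.ρ β S (c * Real.sqrt s) C₀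

/-! ## §5 (pooled prover ym-ir-line-pool-p3 g2, 2026-08-28) The `(0, β_D]`-uniform ratio rung for the special-unitary fundamental model,
area law read on even tori — tree constant for the rung `ratioStrongCouplingRP_holds` of `Theorems/IR/TensionRatioRP.lean`
(a typed FORMAT obligation inside `IR`'s known regime, not a claim; proved there from input (a) =
`Theorems/IR/StrongCouplingRateColdPressure.lean`, the rate-tracking strong-coupling cold pressure bound) -/

/-- **rung T2-sc-RP — the ratio format with ONE constant `c` on ALL of `(0, β_D]`, special-unitary fundamental model, area law read on
even tori.**  For every simply-connected compact simple `G` and every lattice representation `r` that is a special-unitary model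
(`range r.ρ = SU(N)`, `N ≥ 2`, so `π := r.ρ` is centre-charged) there are `c > 0` and `βD > 0` such that for ALL `β ∈ (0, βD]`, all `s > 0`,
all `C`: an area law `(C, s)` for the fundamental `R×T` loops in the `(0,1)` plane on all large EVEN tori (`2R, 2T ≤ L`) implies the cold
trace bound at rate `c·√s` on all large odd tori `2S+1` — the constant `c` does NOT shrink as `β → 0⁺`.  This is the quantifier shape of
the registered rung `RatioStrongCoupling` (T2-sc: `∃ c, ∃ βD, ∀ β ∈ (0, βD]`) on the hypothesis vocabulary of `RatioStrongCouplingWindowRP`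
(§4; there `c = c(β₁)` may shrink with the window).  Inputs: (i) the torus Seiler/Bachas RP bound p592927 + the plaquette floor
`⟨W_{1×1}⟩ ≥ c_pl β` (`exists_plaquette_ge_linear`) cap the admissible rate, `s ≤ log(1/(c_pl β))`; (ii) the RATE-TRACKING strong-coupling
cold pressure bound `coldPressureBound_strongCoupling_log` (rate `(1 + log(r_ρ/β))/8`, `Theorems/IR/StrongCouplingRateColdPressure.lean`)
dominates `c·√(log(1/(c_pl β)))` uniformly on `(0, βD]` — which the β-independent rate `1/8` of `coldPressureAt_strongCoupling` cannot.
Implies `RatioStrongCouplingWindowRP` (`ratioStrongCouplingWindowRP_of_ratioStrongCouplingRP`, below).  Inside `IR`'s known regime; exercises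
T2's interfaces; not consumed by `IR_of`.  [rung; provable — proved in `Theorems/IR/TensionRatioRP.lean`] -/
def RatioStrongCouplingRP : Prop :=
  ∀ (G : Type) [Group G] [TopologicalSpace G] [IsTopologicalGroup G] [CompactSpace G],
    IsCompactSimpleLieGroup G → SimplyConnectedSpace G →
    letI : MeasurableSpace G := borel G; haveI : BorelSpace G := ⟨rfl⟩;
    ∀ (r : LatticeRep G), IsSpecialUnitaryModel r.ρ → 2 ≤ r.N →
      ∃ c : ℝ, 0 < c ∧ ∃ βD : ℝ, 0 < βD ∧ ∀ β : ℝ, 0 < β → β ≤ βD → ∀ s : ℝ, 0 < s → ∀ C : ℝ,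
        (∃ L₂ : ℕ, ∀ (L : ℕ) [NeZero L], L₂ ≤ L → Even L → ∀ R T : ℕ, 1 ≤ R → 1 ≤ T → 2 * R ≤ L → 2 * T ≤ L →
            |wilsonExpectation r.ρ β (wilsonLoop r.ρ (0 : Literature.MathematicalPhysics.QuantumFieldTheory.Site 4 L) 0 1 R T)| ≤
              C ^ (2 * (R + T)) * Real.exp (-(s * R * T))) →
          ∃ C₀ : ℝ, 0 ≤ C₀ ∧ ∃ S₃ : ℕ, ∀ S : ℕ, S₃ ≤ S → ColdPressureBound r.ρ β S (c * Real.sqrt s) C₀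

/-- **The `(0, β_D]`-uniform RP rung implies the window RP rung (real proof):** a constant uniform on `(0, βD]` serves every window. -/
theorem ratioStrongCouplingWindowRP_of_ratioStrongCouplingRP (h : RatioStrongCouplingRP) : RatioStrongCouplingWindowRP := by
  intro G _ _ _ _ hG hsc r hSU hN2
  obtain ⟨c, hc, βD, hβD, hmain⟩ := h G hG hsc r hSU hN2
  refine ⟨βD, hβD, fun β₁ hβ₁ _ => ⟨c, hc, fun β hβ₁β hββD s hs C hAL => ?_⟩⟩
  exact hmain β (lt_of_lt_of_le hβ₁ hβ₁β) hββD s hs C hAL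

/-! ## §6 (pooled prover ym-ir-line-pool-p3 g2, 2026-08-28) The ONE remaining input of the registered rung T2-sc after input (a) landed:
the strong-coupling LOOP FLOOR on odd tori — tree constant for the reduction `ratioStrongCoupling_of_loopFloorSC : LoopFloorSC → RatioStrongCoupling`
of `Theorems/IR/TensionRatioOfLoopFloor.lean` (a typed obligation of the line, not a claim and not a literature fact) -/

/-- **input (b) of rung T2-sc — the STRONG-COUPLING LOOP FLOOR on odd tori (an a-priori LOWER bound of area type for centre-charged Wilson
loops, volume by volume).**  For every simply-connected compact simple `G`, every lattice representation `r` and every centre-charged continuous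
`π` there are `βL > 0`, an exponent `k : ℕ` and `w > 0` such that for every `β ∈ (0, βL]` and every `n ≥ 1`, on all large odd tori `2S+1` the square
loop obeys `(w·β^k)^{n²} ≤ |⟨χ_π(W_{n×n})⟩_{2S+1,β}|` (`χ_π = (1/N) Re tr π`, the line's `torusRect`).  Content: the leading strong-coupling behaviour
`⟨χ_π(W_{n×n})⟩ ≍ e^{−σ_π(β) n² − μ n}` with `σ_π(β) = k_π log(1/β) + O(1)`, `μ = O(1)` (Osterwalder–Seiler 1978 §5; Seiler's a-priori bound
`⟨W(C)⟩ ≥ e^{−σ_max·Area}`, Phys. Rev. D 18 (1978) 482, is its reflection-positivity form), read as a one-sided bound with the perimeter and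
constant factors absorbed into `w` (`n ≤ n²`).  In the tree: the EVEN-torus RP chain `⟨W_{1×1}⟩^{n²} ≤ ⟨W_{n×n}⟩` (p592927) and the plaquette floor
`⟨W_{1×1}⟩ ≥ c_pl β` for the special-unitary fundamental model (`exists_plaquette_ge_linear`) give exactly this shape on EVEN tori with `k = 1`
(used by `ratioStrongCouplingRP_holds`); on the line's ODD tori `2S+1` and for a general centre-charged `π` (π-plaquette positivity floor
`⟨χ_π(U_p)⟩ ≥ w β^{k_π}`, `k_π` = least tensor degree of `r.ρ, r.ρ̄` containing `π̄`) it is NOT in the tree — the strong-coupling surface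
(decorated-sheet) expansion.  Its ONLY use: capping the admissible area-law rate, `s ≤ −log(w β^k) = k·log(1/β) − log w`, in
`RatioStrongCoupling` ∕ `RatioStrongCouplingWindow`; with input (a) (`StrongCouplingRate.coldPressureBound_strongCoupling_log`, rate
`(1 + log(r_ρ/β))/8`) this closes T2-sc (`ratioStrongCoupling_of_loopFloorSC`).  Size L–XL.  [input; open — a typed obligation of the line] -/
def LoopFloorSC : Prop :=
  ∀ (G : Type) [Group G] [TopologicalSpace G] [IsTopologicalGroup G] [CompactSpace G],
    IsCompactSimpleLieGroup G → SimplyConnectedSpace G →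
    letI : MeasurableSpace G := borel G; haveI : BorelSpace G := ⟨rfl⟩;
    ∀ (r : LatticeRep G) (N : ℕ) (π : G →* Matrix (Fin N) (Fin N) ℂ) (z : G) (ω : ℂ), 0 < N → Continuous π →
      z ∈ Subgroup.center G → ω ≠ 1 → π z = ω • (1 : Matrix (Fin N) (Fin N) ℂ) →
      ∃ βL : ℝ, 0 < βL ∧ ∃ (k : ℕ) (w : ℝ), 0 < w ∧ ∀ β : ℝ, 0 < β → β ≤ βL → ∀ n : ℕ, 1 ≤ n →
        ∃ S₀ : ℕ, ∀ S : ℕ, S₀ ≤ S →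
          (w * β ^ k) ^ (n * n) ≤ |torusRect r.ρ (fun g => normalisedCharacter N (π g)) β S n n|

/-! ## §7 (pooled prover ym-ir-line-pool-p3 g2, 2026-08-28) The loop floor REDUCED to the `π`-PLAQUETTE floor: with the odd-torus Seiler–Bachas
bound for `π`-loops (`Theorems/IR/TorusWilsonLoopRepOddPlaquetteBound.lean`) `LoopFloorSC` follows from the floor of the single `π`-plaquette;
tree constant for `loopFloorSC_of_plaquetteFloorSC` ∕ `ratioStrongCoupling_of_plaquetteFloorSC` there (a typed obligation, not a claim). -/

/-- **input (b2) of rung T2-sc — the STRONG-COUPLING `π`-PLAQUETTE FLOOR on odd tori.**  For every simply-connected compact simple `G`, every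
lattice representation `r` and every centre-charged continuous `π` there are `βP > 0`, an exponent `k : ℕ` and `w > 0` such that for every
`β ∈ (0, βP]`, on all large odd tori `2S+1`, the mean `π`-plaquette is at least `w β^k`: `w·β^k ≤ ⟨χ_π(U_p)⟩_{2S+1,β}` (`χ_π = (1/N) Re tr π`;
the line's `torusRect … S 1 1`).  Content: the leading order of the strong-coupling expansion of a LOCAL observable, uniformly in the volume —
`⟨χ_π(U_p)⟩ = c_k β^k + O(β^{k+1})` with `k = k_π` the least total tensor degree of `r.ρ, r.ρ̄` containing a constituent of `π̄` and
`c_k = E_Haar[χ_π · (Re tr r.ρ)^k]/k! > 0` (Osterwalder–Seiler 1978 §3; Montvay–Münster §3.4); in the tree only for `π = r.ρ` special unitary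
(`PlaquetteLowerBound.wilsonExpectation_plaquette_ge`, `k = 1`).  With the odd-torus reflection-positivity chain it gives `LoopFloorSC`
(`loopFloorSC_of_plaquetteFloorSC`) and hence the registered rungs T2-sc ∕ T2-sc-window.  Size L (fixed small `k`) to XL (general `π`).
[input; open — a typed obligation of the line] -/
def PlaquetteFloorSC : Prop :=
  ∀ (G : Type) [Group G] [TopologicalSpace G] [IsTopologicalGroup G] [CompactSpace G],
    IsCompactSimpleLieGroup G → SimplyConnectedSpace G →
    letI : MeasurableSpace G := borel G; haveI : BorelSpace G := ⟨rfl⟩;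
    ∀ (r : LatticeRep G) (N : ℕ) (π : G →* Matrix (Fin N) (Fin N) ℂ) (z : G) (ω : ℂ), 0 < N → Continuous π →
      z ∈ Subgroup.center G → ω ≠ 1 → π z = ω • (1 : Matrix (Fin N) (Fin N) ℂ) →
      ∃ βP : ℝ, 0 < βP ∧ ∃ (k : ℕ) (w : ℝ), 0 < w ∧ ∀ β : ℝ, 0 < β → β ≤ βP →
        ∃ S₀ : ℕ, ∀ S : ℕ, S₀ ≤ S →
          w * β ^ k ≤ torusRect r.ρ (fun g => normalisedCharacter N (π g)) β S 1 1

end Summit.QuantumFields.YangMills.Cruxes.IR.TensionRatio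

end
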